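/-
Copyright (c) 2026. All rights reserved.
Released under Apache 2.0 license as described in the file LICENSE.
Authors: abc-iut cell, prover seat abc-iut-w5-d053 (gen 5; row «OPENAUG-SUBMODEL» = E-L4-16 of the L4 lead), over
abc-iut-L4-t9's MLF model categories, abc-iut-w4-d095's genuine nonarchimedean §5 rows and abc-iut-w6-d036's
mono-analyticization of the base (see the imports).
-/
import Literature.AnabelianGeometry.AbsoluteAnabelian.LogFrobeniusMonoGenuineProp58vii
import Literature.AnabelianGeometry.AbsoluteAnabelian.AbsTopIII.BiAnabelianModelProofs
import HarnessLib

/-!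
# [AbsTopIII] Def 3.1 (i): the OPEN-AUGMENTATION sub-model `𝒳^{open} ⊆ 𝒳 = 𝒞^{MLF}_{TF}` and the §5 rows cut down to a
# full subcategory of the MLF model (Def 5.4 (iv), Def 5.6 (ii)/(iii), Prop 5.8 (vii))

S. Mochizuki, *Topics in absolute anabelian geometry III*, J. Math. Sci. Univ. Tokyo 22 (2015) [MochizukiAbsTopIII2015];
locators = pages of the kurims manuscript (`paper:url-5493eb38cbb7`): Def 3.1 (i) p. 66 ("Let `Π_k` be a topological
group, equipped with a continuous surjection `ε_k : Π_k ↠ G_k`"; print's `Π_k` is the PROFINITE `Π_X` of a hyperbolic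
orbicurve of strictly Belyi type, for which `ε_k` is automatically OPEN), Def 5.4 (iv) p. 127, Def 5.6 (ii)(iii) pp. 135–136,
Prop 5.8 (vii) p. 141, Cor 5.10 (iv) p. 147.

## Why (abc-iut-f-101 gen 4, finding «MTC-EMPTY-AT-MONOAN», 2026-08-26T22:24Z)

abc-iut-L4-t9's model category `TFModel p` types Def 3.1 (i) verbatim: `ε_k` is only a continuous surjection.  At an object
whose `ε_k` is NOT open (e.g. `Π := G_k` with the DISCRETE topology) the arithmetic quotient `Π_k ⧸ Ker ε_k` (quotient
topology) is not isomorphic, as a topological group, to `G_k = Gal(ℚ̄_p/k)` (Krull topology), so no mono-analytic comparison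
isomorphism `η⊢` (Cor 5.10 (iv)(c)) exists there.  The honest positive carrier is print's own case: the full subcategory of
objects with OPEN augmentation.  This file supplies (row «OPENAUG-SUBMODEL» items (a), (c), (d); item (b) — the canonical
`Π_k ⧸ N ≃ₜ* G_k` and the four `η⊢`-components — is abc-iut-f-101's `LogFrobeniusMonoEtaComponents.lean`):

* (a) `TFModel.IsOpenAug : ObjectProperty (TFModel p)` (`IsOpenMap A.D.aug`), categorical (`isOpenAug_of_iso`), the full
  subcategory `TFModelOpen p` with its fully faithful inclusion `TFModelOpen.ι` and the lift `TFModelOpen.ιUp`;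
* (c) inhabitants: every object with COMPACT `Π_k` (print's profinite case, `isOpenAug_of_compactSpace`: a continuous
  surjective HOMOMORPHISM from a compact group onto the Hausdorff `G_k` is closed, hence a quotient map, hence open) and the
  genuine `(G_k, id)` (`isOpenAug_monoAnabelianlytic` = abc-iut-L4-t9's `TFModel.monoAnalytic`);
* (d) the §5 holomorphic rows of abc-iut-w4-d095 / abc-iut-w6-d036 (`nonarchLam`, `nonarchIota`, `nonarchLamOver`,
  `toMonoBase`, `nonarchMonoNAn`) RESTRICTED along the inclusion `P.ι` of an ARBITRARY full subcategory
  `P : ObjectProperty (TFModel p)`, and the assembled §5 setting `LogFrobeniusSetting.nonarchGenuineMonoAnSub p P ψ`,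
  generic in the sub-model `P` AND in the mono-analytic container family `ψ` (abc-iut-w6-d036's `ψMono`, abc-iut-w4-d095's
  `ψMonoPf`), with the same five structural lemmas as `LogFrobeniusMonoGenuineProp58vii.lean` (rows 4 → 5 and 6 → 7 on the
  nose, the mono-analyticization homotopies, Cor 5.10 (iv)(a)).  STRUCTURAL NOTE: restricting `𝒳` forces restricting
  `ℰ•`, `An•[𝒳]` and `𝒩⊞_v = 𝒩_v = 𝒳 × 𝒞_TS` to the same objects (`κ_{An•} : ℰ• ≌ An•`, the equivalence
  `φ_{An•} : An• ⥤ 𝒳` and `𝒩_v ⥤ ℰ•` tie them to `𝒳`); the MONO-ANALYTIC side (`ℰ⊢ = Up MonoBase`, `𝒩⊢⊞_w`, `𝒩⊢_w`,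
  `An⊢ = Up AnMono`, `κ_{An⊢}`) is unchanged.  The open-augmentation setting of row «MTC-GENUINE-POSITIVE-OPENAUG» is then
  `nonarchGenuineMonoAnSub p TFModel.IsOpenAug MLFClosure.ψMonoPf` (file `LogFrobeniusMonoGenuineProp58viiPfOpen.lean`).

HONEST FRAMING: refereed pre-IUT material; kernel DEFINITIONS over the cell's MLF model plus elementary topology; a
sub-MODEL, not a reconstruction; nothing here bears on [IUTchIII] Cor. 3.12; no side taken; typed ≠ proved;
model-level ≠ node-level.
-/

set_option autoImplicit false

noncomputable section

universe u

open CategoryTheory Topology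

namespace Literature.AnabelianGeometry.AbsoluteAnabelian

open AbsTopIII

/-! ## Part 0. A surjective homomorphism of topological groups that is a quotient map is open -/

section OpenOfQuotient

variable {G H : Type*} [Group G] [TopologicalSpace G] [IsTopologicalGroup G] [Group H] [TopologicalSpace H]

/-- A homomorphism of topological groups which is a topological quotient map is an OPEN map: the saturation
`ψ⁻¹(ψ(V)) = ⋃_{k ∈ Ker ψ} V·k` of an open set is open (the mechanism behind "open" in Def 3.1 (ii) for profinite groups).
[cite: MochizukiAbsTopIII2015, Definition 3.1 (ii) p.67] -/
theorem MonoidHom.isOpenMap_of_isQuotientMap' (ψ : G →* H) (hq : IsQuotientMap ψ) : IsOpenMap ψ := by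
  intro V hV
  rw [← hq.isOpen_preimage]
  have hsat : (ψ : G → H) ⁻¹' ((ψ : G → H) '' V) = ⋃ k ∈ ψ.ker, (fun v => v * k) '' V := by
    ext x
    simp only [Set.mem_preimage, Set.mem_image, Set.mem_iUnion, exists_prop]
    constructor
    · rintro ⟨v, hv, hvx⟩
      exact ⟨v⁻¹ * x, by rw [MonoidHom.mem_ker, map_mul, map_inv, hvx, inv_mul_cancel], v, hv,
        mul_inv_cancel_left v x⟩
    · rintro ⟨k, hk, v, hv, rfl⟩
      exact ⟨v, hv, by rw [map_mul, MonoidHom.mem_ker.mp hk, mul_one]⟩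
  rw [hsat]
  exact isOpen_biUnion fun k _ => (Homeomorph.mulRight k).isOpenMap V hV

end OpenOfQuotient

namespace AbsTopIII

namespace TFModel

variable {p : ℕ} [Fact p.Prime]

/-! ## Part 1 (a). The open-augmentation property and the sub-model `𝒳^{open}` -/

/-- **Open augmentation**: the property of a model `TF`-pair `(Π_k ↠ G_k ↷ ℚ̄_p)` that its augmentation
`ε_k : Π_k ↠ G_k` is an OPEN map (automatic in print, where `Π_k = Π_X` is profinite; NOT automatic for the typed
Def 3.1 (i), which asks only "a continuous surjection"). [cite: MochizukiAbsTopIII2015, Definition 3.1 (i) p.66] -/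
def IsOpenAug : ObjectProperty (TFModel p) := fun A => IsOpenMap A.D.aug

/-- Unfolding `IsOpenAug`. [cite: MochizukiAbsTopIII2015, Definition 3.1 (i) p.66] -/
theorem isOpenAug_iff (A : TFModel p) : IsOpenAug A ↔ IsOpenMap A.D.aug := Iff.rfl

/-- At an open-augmentation object, `ε_k` is an open quotient map (surjective, continuous, open).
[cite: MochizukiAbsTopIII2015, Definition 3.1 (i) p.66] -/
theorem IsOpenAug.isOpenQuotientMap {A : TFModel p} (hA : IsOpenAug A) : IsOpenQuotientMap A.D.aug :=
  ⟨A.D.aug_surjective, A.D.continuous_aug, hA⟩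

/-- At an open-augmentation object, `ε_k` is a topological quotient map `Π_k ↠ G_k`.
[cite: MochizukiAbsTopIII2015, Definition 3.1 (i) p.66] -/
theorem IsOpenAug.isQuotientMap {A : TFModel p} (hA : IsOpenAug A) : IsQuotientMap A.D.aug :=
  hA.isOpenQuotientMap.isQuotientMap

/-! ## Part 1 (c). Inhabitants: quotient augmentations, COMPACT `Π_k` (print's profinite case), `(G_k, id)` -/

/-- `ε_k` a topological quotient map ⇒ open augmentation (a quotient HOMOMORPHISM is open).
[cite: MochizukiAbsTopIII2015, Definition 3.1 (i) p.66] -/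
theorem isOpenAug_of_isQuotientMap (A : TFModel p) (h : IsQuotientMap A.D.aug) : IsOpenAug A :=
  MonoidHom.isOpenMap_of_isQuotientMap' A.D.aug h

/-- **Print's case: every model object with COMPACT (e.g. profinite) `Π_k` has open augmentation** — a continuous
surjection from a compact space onto the Hausdorff Krull group `G_k = Gal(ℚ̄_p/k)` is closed, hence a quotient map, hence
(being a homomorphism) open. [cite: MochizukiAbsTopIII2015, Definition 3.1 (i) p.66] -/
theorem isOpenAug_of_compactSpace (A : TFModel p) [CompactSpace A.D.Pi] : IsOpenAug A := by
  haveI : Algebra.IsAlgebraic A.k (PadicAlgCl p) := A.isAlgebraic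
  haveI : T2Space (PadicAlgCl p ≃ₐ[A.k] PadicAlgCl p) := krullTopology_t2
  exact isOpenAug_of_isQuotientMap A
    (A.D.continuous_aug.isClosedMap.isQuotientMap A.D.continuous_aug A.D.aug_surjective)

/-- A bijective augmentation which is a homeomorphism onto `G_k` is open (the "mono-analytic type" objects
`Π_k ⥲ G_k` of Def 3.1 (ii) with the right topology). [cite: MochizukiAbsTopIII2015, Definition 3.1 (ii) p.67] -/
theorem isOpenAug_of_isHomeomorph (A : TFModel p) (h : IsHomeomorph A.D.aug) : IsOpenAug A := h.isOpenMap

variable (p) in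
/-- **The genuine object `(G_k, id)` has open augmentation** (abc-iut-L4-t9's `TFModel.monoAnalytic p k`: `Π_k := G_k`
with the Krull topology, `ε_k := id`). [cite: MochizukiAbsTopIII2015, Definition 3.1 (ii) p.67] -/
theorem isOpenAug_monoAnalytic (k : IntermediateField ℚ_[p] (PadicAlgCl p)) [FiniteDimensional ℚ_[p] k] :
    IsOpenAug (monoAnalytic p k) :=
  IsOpenMap.id

/-! ### `IsOpenAug` is categorical: invariant under Galois-isomorphisms of pairs -/

/-- The augmentations of the source and target of a Galois-isomorphism `f` are intertwined, IN `G_k`-VALUED FORM, by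
conjugation with the field component `σ_f` (abc-iut-L4-t9's `augQ_homPi` + abc-iut-w6-d036's `galConjEquiv`).
[cite: MochizukiAbsTopIII2015, Definition 3.1 (ii) p.67] -/
theorem aug_homPi_eq_galConjEquiv {A B : TFModel p} (f : A ⟶ B) (g : A.pair.Pi) :
    B.D.aug ((f : Hom A B).hom.homPi g) =
      galConjEquiv (f : Hom A B).galois A.k B.k (Hom.galois_mem f) (Hom.galois_symm_mem f) (A.D.aug g) := by
  apply AlgEquiv.ext
  intro x
  have h := congrArg (fun φ : PadicAlgCl p ≃ₐ[ℚ_[p]] PadicAlgCl p => φ x) ((f : Hom A B).augQ_homPi g)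
  simpa only [augQ_apply, AlgEquiv.trans_apply, galConjEquiv_apply] using h

/-- As maps: `ε_B ∘ φ_Π = conj_{σ_f} ∘ ε_A`. [cite: MochizukiAbsTopIII2015, Definition 3.1 (ii) p.67] -/
theorem aug_comp_homPi_eq {A B : TFModel p} (f : A ⟶ B) :
    (B.D.aug : B.pair.Pi → _) ∘ (f : Hom A B).hom.homPi =
      galConjEquiv (f : Hom A B).galois A.k B.k (Hom.galois_mem f) (Hom.galois_symm_mem f) ∘ (A.D.aug : A.pair.Pi → _) :=
  funext fun g => aug_homPi_eq_galConjEquiv f g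

/-- **`IsOpenAug` is invariant under morphisms of `𝒳`** (all of which are Galois-isomorphisms): `ε_B = conj_{σ_f} ∘ ε_A ∘ φ_Π⁻¹`
with `conj_{σ_f}` and `φ_Π` homeomorphisms — the sub-model is "determined by" isomorphism classes, as print's subcategories
are. [cite: MochizukiAbsTopIII2015, Definition 3.1 (iii) p.67] -/
theorem isOpenAug_of_hom {A B : TFModel p} (f : A ⟶ B) (hA : IsOpenAug A) : IsOpenAug B := by
  have hφ : IsOpenMap ((f : Hom A B).piIso.symm : B.pair.Pi → A.pair.Pi) := (f : Hom A B).piIso.symm.isOpenMap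
  have hc : IsOpenMap (galConjEquiv (f : Hom A B).galois A.k B.k (Hom.galois_mem f) (Hom.galois_symm_mem f)) :=
    (galConjEquiv (f : Hom A B).galois A.k B.k (Hom.galois_mem f) (Hom.galois_symm_mem f)).toHomeomorph.isOpenMap
  have heq : (B.D.aug : B.pair.Pi → _) =
      (galConjEquiv (f : Hom A B).galois A.k B.k (Hom.galois_mem f) (Hom.galois_symm_mem f) ∘ (A.D.aug : A.pair.Pi → _)) ∘
        ((f : Hom A B).piIso.symm : B.pair.Pi → A.pair.Pi) := by
    rw [← aug_comp_homPi_eq f]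
    funext g
    change B.D.aug g = B.D.aug ((f : Hom A B).hom.homPi ((f : Hom A B).piIso.symm g))
    rw [← Hom.piIso_apply, ContinuousMulEquiv.apply_symm_apply]
  rw [isOpenAug_iff, heq]
  exact (hc.comp hA).comp hφ

/-- `IsOpenAug` transported along an isomorphism of `𝒳`. [cite: MochizukiAbsTopIII2015, Definition 3.1 (iii) p.67] -/
theorem isOpenAug_of_iso {A B : TFModel p} (e : A ≅ B) (hA : IsOpenAug A) : IsOpenAug B := isOpenAug_of_hom e.hom hA

/-- `IsOpenAug` is an isomorphism-invariant property: `A ≅ B → (IsOpenAug A ↔ IsOpenAug B)`.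
[cite: MochizukiAbsTopIII2015, Definition 3.1 (iii) p.67] -/
theorem isOpenAug_iff_of_iso {A B : TFModel p} (e : A ≅ B) : IsOpenAug A ↔ IsOpenAug B :=
  ⟨isOpenAug_of_iso e, isOpenAug_of_iso e.symm⟩

end TFModel

/-- **The open-augmentation sub-model `𝒳^{open}`**: the full subcategory of abc-iut-L4-t9's `𝒳 = TFModel p` on the objects
with OPEN `ε_k : Π_k ↠ G_k` (contains every object with profinite `Π_k`, i.e. all of print's objects).
[cite: MochizukiAbsTopIII2015, Definition 3.1 (i) p.66] -/
abbrev TFModelOpen (p : ℕ) [Fact p.Prime] : Type 1 := (TFModel.IsOpenAug (p := p)).FullSubcategory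

namespace TFModelOpen

variable (p : ℕ) [Fact p.Prime]

/-- The (fully faithful) inclusion `𝒳^{open} ⥤ 𝒳`. [cite: MochizukiAbsTopIII2015, Definition 3.1 (iii) p.67] -/
abbrev ι : TFModelOpen p ⥤ TFModel p := (TFModel.IsOpenAug (p := p)).ι

/-- The inclusion lifted one universe (`Up`), for the §5 interface. [cite: MochizukiAbsTopIII2015, Definition 5.4 (iv) p.127] -/
abbrev ιUp : Up (TFModelOpen p) ⥤ Up (TFModel p) := Up.liftF (ι p)

/-- The genuine object `(G_k, id)` as an object of `𝒳^{open}`. [cite: MochizukiAbsTopIII2015, Definition 3.1 (ii) p.67] -/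
def monoAnalytic (k : IntermediateField ℚ_[p] (PadicAlgCl p)) [FiniteDimensional ℚ_[p] k] : TFModelOpen p :=
  ⟨TFModel.monoAnalytic p k, TFModel.isOpenAug_monoAnalytic p k⟩

variable {p} in
/-- Any model object with compact `Π_k` as an object of `𝒳^{open}`. [cite: MochizukiAbsTopIII2015, Definition 3.1 (i) p.66] -/
def ofCompact (A : TFModel p) [CompactSpace A.D.Pi] : TFModelOpen p := ⟨A, TFModel.isOpenAug_of_compactSpace A⟩

/-- `𝒳^{open}` is inhabited (by `(G_{ℚ_p}, id)`). [cite: MochizukiAbsTopIII2015, Definition 3.1 (ii) p.67] -/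
theorem nonempty : Nonempty (TFModelOpen p) := ⟨monoAnalytic p ⊥⟩

/-- The augmentation of an object of `𝒳^{open}` is open (the defining property, by name).
[cite: MochizukiAbsTopIII2015, Definition 3.1 (i) p.66] -/
theorem isOpenMap_aug (A : TFModelOpen p) : IsOpenMap A.obj.D.aug := A.property

end TFModelOpen

end AbsTopIII

/-! ## Part 2 (d). The §5 holomorphic rows RESTRICTED to a full subcategory `P` of the MLF model -/

namespace LogFrobeniusSetting

variable (p : ℕ) [Fact p.Prime] (P : ObjectProperty (TFModel p))

/-- `λ⊞_{v,ν}` on the sub-model: `A ↦ (A, λ_ν(A))` with abc-iut-w4-d095's six local components `nonarchLoc` precomposed with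
the inclusion `P.ι`; archimedean placeholder as in `nonarchLam`. [cite: MochizukiAbsTopIII2015, Definition 5.4 (iv) p.127] -/
def nonarchLamSub : (b : Bool) → LogVertex b → (Up P.FullSubcategory ⥤ Up (P.FullSubcategory × TSObj))
  | false, ν => Up.liftF ((𝟭 P.FullSubcategory).prod' (P.ι ⋙ nonarchLoc p ν))
  | true, _ => Up.liftF ((𝟭 P.FullSubcategory).prod' (P.ι ⋙ TFModel.lamAdd p))

/-- `ι_{v,ε}` before the twist on the sub-model: `(𝟙, ι_ε ∘ P.ι)`; identity at an archimedean place (placeholder).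
[cite: MochizukiAbsTopIII2015, Definition 5.4 (vii) p.128] -/
def nonarchIotaCoreSub : (b : Bool) → {ν₁ ν₂ : LogVertex b} → LogEdgeTS b ν₁ ν₂ →
    (nonarchLamSub p P b ν₁ ⟶ nonarchLamSub p P b ν₂)
  | false, _, _, ε => Up.liftT (NatTrans.prod' (𝟙 (𝟭 P.FullSubcategory)) (Functor.whiskerLeft P.ι (nonarchLocIota p ε)))
  | true, _, _, _ => 𝟙 _

/-- `Λ_ν ∘ λ = λ` for the identity log-Frobenius functor on the sub-model. [cite: MochizukiAbsTopIII2015, Def 5.4 (vii) p. 128] -/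
theorem frobeniusTwist_id_comp_sub (c : Bool) (F : Up P.FullSubcategory ⥤ Up (P.FullSubcategory × TSObj)) :
    frobeniusTwist (𝟭 (Up P.FullSubcategory)) c ⋙ F = F := by
  cases c <;> rfl

/-- `ι⊞_{v,ε}` of the sub-model on `Γ⃗^⋉_v`. [cite: MochizukiAbsTopIII2015, Definition 5.4 (vii) p.128] -/
def nonarchIotaSub (b : Bool) {ν₁ ν₂ : LogVertex b} (ε : LogEdge b ν₁ ν₂) :
    frobeniusTwist (𝟭 (Up P.FullSubcategory)) ν₁.isPostLog ⋙ nonarchLamSub p P b ν₁ ⟶ nonarchLamSub p P b ν₂ :=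
  eqToHom (frobeniusTwist_id_comp_sub p P _ _) ≫ nonarchIotaCoreSub p P b ε.toTS

/-- The space-link and post-log functors coincide on the sub-model (log-coordinates).
[cite: MochizukiAbsTopIII2015, Cor 5.5 p. 130] -/
theorem nonarchLamSub_spaceLink_eq_postLog (b : Bool) :
    nonarchLamSub p P b (LogVertex.spaceLink b) = nonarchLamSub p P b (LogVertex.postLog b) := by
  cases b <;> rfl

/-- `λ⊞_{v,ν}` lies over the base on the sub-model: `(A, λ_ν(A)) ↦ A` is the identity.
[cite: MochizukiAbsTopIII2015, Definition 5.4 (iv) p.127] -/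
def nonarchLamOverSub : (b : Bool) → (ν : LogVertex b) →
    (nonarchLamSub p P b ν ⋙ 𝟭 (Up (P.FullSubcategory × TSObj)) ⋙
        Up.liftF (CategoryTheory.Prod.fst P.FullSubcategory TSObj) ≅ 𝟭 (Up P.FullSubcategory))
  | false, _ => NatIso.ofComponents (fun _ => Iso.refl _) (fun _ => InducedCategory.hom_ext (by
      simp only [Functor.comp_map, Functor.id_map]; rfl))
  | true, _ => NatIso.ofComponents (fun _ => Iso.refl _) (fun _ => InducedCategory.hom_ext (by
      simp only [Functor.comp_map, Functor.id_map]; rfl))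

/-- The mono-analyticization of the base on the sub-model: abc-iut-w6-d036's `toMonoBase` `(Π_k ↠ G_k ↷ ℚ̄_p) ↦ (k, ℚ̄_p)`
precomposed with `P.ι`. [cite: MochizukiAbsTopIII2015, Definition 5.6 (ii) p.135] -/
def toMonoBaseSub : P.FullSubcategory ⥤ MLFClosure.MonoBase := P.ι ⋙ TFModel.toMonoBase p

/-- The mono-analyticization `𝒩_v → 𝒩⊢_v` on the sub-model: base by `toMonoBaseSub`, local `TS`-pair by `TSObj.monoAn`.
[cite: MochizukiAbsTopIII2015, Definition 5.6 (iii) p.136] -/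
def nonarchMonoNAnSub : Up (P.FullSubcategory × TSObj) ⥤ Up (MLFClosure.MonoBase × TSObj) :=
  Up.liftF ((toMonoBaseSub p P).prod TSObj.monoAn)

/-- **The §5 setting with genuine nonarchimedean rows and genuine mono-analytic base, CUT DOWN to the full subcategory `P`
of the MLF model, with mono-analytic container family `ψ`** (abc-iut-w6-d036's `nonarchGenuineMonoAn p` is the case
`P = ⊤`, `ψ = ψMono` up to the identification `⊤.FullSubcategory ≃ TFModel p`; abc-iut-w4-d095's `nonarchGenuineMonoAnPf`
is `ψ = ψMonoPf`): `𝒳 = ℰ• = An• := Up P.FullSubcategory`, `𝒩⊞_v = 𝒩_v := Up (P.FullSubcategory × 𝒞_TS)`, holomorphic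
rows = the restricted rows above; mono-analytic side unchanged (`ℰ⊢ := Up MonoBase`, `An⊢ := Up AnMono`,
`ψ^{An⊢⊞}_{w,ν} := ψ`). [cite: MochizukiAbsTopIII2015, Prop 5.8 (vii) p.141] -/
def nonarchGenuineMonoAnSub (ψ : (b : Bool) → LogVertex b → (MLFClosure.AnMono ⥤ MLFClosure.MonoBase × TSObj))
    (Vmod : Type 1) (isArc : Vmod → Bool) : LogFrobeniusSetting Vmod isArc where
  X := Up P.FullSubcategory
  E := Up P.FullSubcategory
  proj := 𝟭 _
  log := 𝟭 _
  logIsoId := Iso.refl _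
  logOver := Iso.refl _
  Nplus _ := Up (P.FullSubcategory × TSObj)
  N _ := Up (P.FullSubcategory × TSObj)
  forget _ := 𝟭 _
  toE _ := Up.liftF (CategoryTheory.Prod.fst P.FullSubcategory TSObj)
  lam v := nonarchLamSub p P (isArc v)
  lamOver v := nonarchLamOverSub p P (isArc v)
  lam_spaceLink_eq_postLog v := nonarchLamSub_spaceLink_eq_postLog p P (isArc v)
  iota v _ _ ε := nonarchIotaSub p P (isArc v) ε
  An := Up P.FullSubcategory
  κAn := CategoryTheory.Equivalence.refl
  φAn := 𝟭 _
  φAn_isEquivalence := inferInstance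
  ηAn := Iso.refl _
  κAn₂ := CategoryTheory.Equivalence.refl
  Emono := Up MLFClosure.MonoBase
  monoAn := Up.liftF (toMonoBaseSub p P)
  NmonoPlus _ := Up (MLFClosure.MonoBase × TSObj)
  Nmono _ := Up (MLFClosure.MonoBase × TSObj)
  forgetMono _ := 𝟭 _
  toEmono _ := Up.liftF (CategoryTheory.Prod.fst MLFClosure.MonoBase TSObj)
  monoNplus _ := nonarchMonoNAnSub p P
  monoN _ := nonarchMonoNAnSub p P
  monoHomotopy _ := Iso.refl _
  AnMono := Up MLFClosure.AnMono
  κAnMono := Up.liftE MLFClosure.anMonoEquiv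
  ψAnMono w ν := Up.liftF (ψ (isArc w) ν.1)

variable (ψ : (b : Bool) → LogVertex b → (MLFClosure.AnMono ⥤ MLFClosure.MonoBase × TSObj))
  (Vmod : Type 1) (isArc : Vmod → Bool)

/-- `ψ^{An⊢⊞}_{w,ν}` of the sub-model setting IS `ψ`. [cite: MochizukiAbsTopIII2015, Prop 5.8 (vii) p.141] -/
theorem nonarchGenuineMonoAnSub_ψAnMono (w : Vmod) (ν : {ν : LogVertex (isArc w) // ν.IsCross}) :
    (nonarchGenuineMonoAnSub p P ψ Vmod isArc).ψAnMono w ν = Up.liftF (ψ (isArc w) ν.1) := rfl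

/-- `𝒳` of the sub-model setting is the lifted sub-model. [cite: MochizukiAbsTopIII2015, Definition 5.4 (iv) p.127] -/
theorem nonarchGenuineMonoAnSub_X : (nonarchGenuineMonoAnSub p P ψ Vmod isArc).X = Up P.FullSubcategory := rfl

/-- If the container family lies over the base on the nose (`ψ_ν ⋙ fst = ι_{AnMono}`, true by `rfl` for `ψMono` and
`ψMonoPf`), then `ψ^{An⊢⊞}_{w,ν}` of the sub-model setting lies over `ℰ⊢` ON THE NOSE.
[cite: MochizukiAbsTopIII2015, Definition 5.6 (iii) p.136] -/
theorem nonarchGenuineMonoAnSub_ψOver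
    (hψ : ∀ (b : Bool) (ν : LogVertex b), ψ b ν ⋙ CategoryTheory.Prod.fst MLFClosure.MonoBase TSObj = inducedFunctor _)
    (w : Vmod) (ν : {ν : LogVertex (isArc w) // ν.IsCross}) :
    (nonarchGenuineMonoAnSub p P ψ Vmod isArc).ψAnMono w ν ⋙ (nonarchGenuineMonoAnSub p P ψ Vmod isArc).forgetMono w ⋙
        (nonarchGenuineMonoAnSub p P ψ Vmod isArc).toEmono w =
      (nonarchGenuineMonoAnSub p P ψ Vmod isArc).κAnMono.inverse := by
  change Up.liftF (ψ (isArc w) ν.1) ⋙ 𝟭 _ ⋙ Up.liftF (CategoryTheory.Prod.fst MLFClosure.MonoBase TSObj) =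
    Up.liftF MLFClosure.anMonoEquiv.inverse
  rw [MLFClosure.anMonoEquiv_inverse, ← hψ (isArc w) ν.1]
  rfl

/-- rows 4 → 5 (`hN`) ON THE NOSE on the sub-model: `𝒩_v → 𝒩⊢_v → ℰ⊢ = 𝒩_v → ℰ• → ℰ⊢ = (A, (Π ↷ M)) ↦ (k_A, ℚ̄_p)`.
[cite: MochizukiAbsTopIII2015, Cor 5.10 p. 146] -/
theorem nonarchGenuineMonoAnSub_monoN_toEmono_eq (v : Vmod) :
    (nonarchGenuineMonoAnSub p P ψ Vmod isArc).monoN v ⋙ (nonarchGenuineMonoAnSub p P ψ Vmod isArc).toEmono v =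
      (nonarchGenuineMonoAnSub p P ψ Vmod isArc).toE v ⋙ (nonarchGenuineMonoAnSub p P ψ Vmod isArc).monoAn := rfl

/-- rows 6 → 7 (`hκ`) ON THE NOSE on the sub-model. [cite: MochizukiAbsTopIII2015, Cor 5.10 p. 146] -/
theorem nonarchGenuineMonoAnSub_κAn₂_monoAn_eq :
    (nonarchGenuineMonoAnSub p P ψ Vmod isArc).κAn₂.functor ⋙ (nonarchGenuineMonoAnSub p P ψ Vmod isArc).monoAn =
      (nonarchGenuineMonoAnSub p P ψ Vmod isArc).κAn.inverse ⋙ (nonarchGenuineMonoAnSub p P ψ Vmod isArc).monoAn := rfl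

/-- abc-iut-L4-t3's add-on `MonoAnalyticizationHomotopies` is INHABITED at the sub-model setting (`hN` canonical;
`anToE` = the unit of the genuine Prop 5.8 (vii) equivalence). [cite: MochizukiAbsTopIII2015, Cor 5.10 p. 146] -/
def nonarchGenuineMonoAnSub_monoAnalyticizationHomotopies :
    (nonarchGenuineMonoAnSub p P ψ Vmod isArc).MonoAnalyticizationHomotopies where
  toE v := eqToIso (nonarchGenuineMonoAnSub_monoN_toEmono_eq p P ψ Vmod isArc v)
  anToE := Functor.isoWhiskerLeft
    ((nonarchGenuineMonoAnSub p P ψ Vmod isArc).κAn.inverse ⋙ (nonarchGenuineMonoAnSub p P ψ Vmod isArc).monoAn)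
    (nonarchGenuineMonoAnSub p P ψ Vmod isArc).κAnMono.unitIso.symm

/-- **[AbsTopIII] Cor 5.10 (iv)(a) HOLDS at the sub-model setting** (abc-iut-L4-t3's `cor510MonoCores_holds` over the
inhabited add-on), for `V(F_mod) ≠ ∅`. [cite: MochizukiAbsTopIII2015, Cor 5.10 (iv)(a) p.147] -/
theorem nonarchGenuineMonoAnSub_cor510MonoCores [Nonempty Vmod] :
    (nonarchGenuineMonoAnSub p P ψ Vmod isArc).Cor510MonoCores :=
  cor510MonoCores_holds (nonarchGenuineMonoAnSub_monoAnalyticizationHomotopies p P ψ Vmod isArc)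

/-- **The open-augmentation case, generic in the container family**: the §5 setting on `𝒳^{open}` — every object of its
`𝒳` has OPEN augmentation (so abc-iut-f-101's `η⊢`-components exist at every object), and it is inhabited.
[cite: MochizukiAbsTopIII2015, Prop 5.8 (vii) p.141] -/
theorem nonarchGenuineMonoAnSub_isOpenAug (A : (nonarchGenuineMonoAnSub p (TFModel.IsOpenAug (p := p)) ψ Vmod isArc).X) :
    IsOpenMap A.down.obj.D.aug :=
  A.down.property

end LogFrobeniusSetting

end Literature.AnabelianGeometry.AbsoluteAnabelian

end
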